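import Summits.AnomalousDissipation.AnomalousDissipation.Theorems.SolenoidalFractalHomogenisationLagrangianStepLabelSplit
import Summits.AnomalousDissipation.AnomalousDissipation.Theorems.SolenoidalFractalHomogenisationLagrangianStepLedgerDD
import HarnessLib

/-!
# K1L_D (stmt-AnomalousDissipation-27980), stub `stub_windowFactsH`: the operator fact (Z) from its four PIECES — `z_of_pieces`
# (the Hilbert-space form of `dd_assembly_op`; helper; `--supports … --as helper`; lead-k1l-onelevel-p1 g3)

(Z) of the window facts asks `|⟪y, e⟫| ≤ ηm √𝔇 √𝔇*(y) + (slop)` for the LOW-LABEL window error `e = P (U u − T u) ∈ V2`.  `dd_assembly_op`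
(…LedgerDD) is the real-variable core: four scalar pairings `A_diag, A_cross, A_fast, A_leak` with dissipation-weighted bounds, and floors
`𝔇 ≥ c(Σ d σ² + F²)`, `𝔇* ≥ c(Σ d y² + Y_f²)`.  THIS FILE lifts it to `V2 = L²(𝕋³;ℝ³)` (memo L6 §2): given a finite SYMMETRIC set `S` of
slow low frequencies and a splitting of the error into V2 pieces `e = e_d + e_c + e_l + e_f` with
* `e_d` (diagonal, own-sector tracking — W6 (V_G)): coefficients on `S` only, `‖𝓕e_d(k)‖ ≤ η₁ d_k ‖𝓕u(k)‖`;
* `e_c` (cross-sector — (X_G⁺)): `|⟪y, e_c⟫| ≤ η₂ √(Σ_S d‖𝓕u‖² + F²) √(Σ_S d‖𝓕y‖² + Y_f²)`;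
* `e_l` (leak into slow low modes — W5 (F_G⁺), x-WEIGHTED): coefficients on `S` only, `Σ_S ‖𝓕e_l(k)‖²/κ′_k ≤ F²`, `κ′_k ≤ η₅² d_k`;
* `e_f` (fast low-label output — W5 (C_G⁺) ⊕ (M♭_G)): NO coefficients on `S`, `‖e_f‖ ≤ √(Σ_S κ‖𝓕u‖²) + η₃ F`, `κ_k ≤ η₄² d_k`;
where `F² = ‖u‖² − Σ_S‖𝓕u‖²`, `Y_f² = ‖y‖² − Σ_S‖𝓕y‖²` (the non-`S` energies, Parseval), and the floors in the same currency, conclude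
`|⟪y, e⟫| ≤ ((η₁+η₂+η₃+η₄+η₅)/c) √𝔇 √𝔇*`.  Pure Hilbert/Fourier bookkeeping (Parseval on `V2` from …LabelSplit, the `S`-projector from
`exists_labelProj`).  NOT a proof of the stub, of the crux, or of AD; rung F-D1.A0.
-/

set_option linter.dupNamespace false

noncomputable section

namespace Summit.AnomalousDissipation.AnomalousDissipation.Theorems.SolenoidalFractalHomogenisation.LagrangianStep

open Literature.Analysis Literature.Analysis.FunctionSpaces
open MeasureTheory Set Filter UnitAddTorus
open scoped ENNReal NNReal InnerProductSpace Classical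
open OneLevelSplit

/-! ## Parseval on a finite support -/

/-- An element of `V2` whose coefficients vanish off a finite set has `‖v‖² = Σ_S ‖𝓕v(k)‖²`. -/
theorem norm_sq_eq_sum_of_support (S : Finset (Fin 3 → ℤ)) (v : V2)
    (hv : ∀ k, k ∉ S → mFourierCoeff (EuclideanSpace.complexify ∘ ⇑v) k = 0) :
    ‖v‖ ^ 2 = ∑ k ∈ S, ‖mFourierCoeff (EuclideanSpace.complexify ∘ ⇑v) k‖ ^ 2 := by
  have h1 := hasSum_norm_sq_fcoeff v
  have h2 : HasSum (fun k : Fin 3 → ℤ => ‖mFourierCoeff (EuclideanSpace.complexify ∘ ⇑v) k‖ ^ 2)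
      (∑ k ∈ S, ‖mFourierCoeff (EuclideanSpace.complexify ∘ ⇑v) k‖ ^ 2) :=
    hasSum_sum_of_ne_finset_zero fun k hk => by rw [hv k hk, norm_zero]; ring
  exact h1.unique h2

/-- Pairing with an `S`-supported element: `⟪y, v⟫ = Σ_S Re⟪𝓕y(k), 𝓕v(k)⟫`. -/
theorem inner_eq_sum_of_support (S : Finset (Fin 3 → ℤ)) (y v : V2)
    (hv : ∀ k, k ∉ S → mFourierCoeff (EuclideanSpace.complexify ∘ ⇑v) k = 0) :
    ⟪y, v⟫_ℝ = ∑ k ∈ S, (inner ℂ (mFourierCoeff (EuclideanSpace.complexify ∘ ⇑y) k)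
      (mFourierCoeff (EuclideanSpace.complexify ∘ ⇑v) k)).re := by
  have h1 := hasSum_inner_fcoeff y v
  have h2 : HasSum (fun k : Fin 3 → ℤ => (inner ℂ (mFourierCoeff (EuclideanSpace.complexify ∘ ⇑y) k)
      (mFourierCoeff (EuclideanSpace.complexify ∘ ⇑v) k)).re)
      (∑ k ∈ S, (inner ℂ (mFourierCoeff (EuclideanSpace.complexify ∘ ⇑y) k)
        (mFourierCoeff (EuclideanSpace.complexify ∘ ⇑v) k)).re) :=
    hasSum_sum_of_ne_finset_zero fun k hk => by rw [hv k hk, inner_zero_right]; simp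
  exact h1.unique h2

/-- Bessel on `V2`: `Σ_S ‖𝓕y(k)‖² ≤ ‖y‖²`. -/
theorem sum_norm_sq_fcoeff_le (S : Finset (Fin 3 → ℤ)) (y : V2) :
    ∑ k ∈ S, ‖mFourierCoeff (EuclideanSpace.complexify ∘ ⇑y) k‖ ^ 2 ≤ ‖y‖ ^ 2 :=
  sum_le_hasSum S (fun _ _ => sq_nonneg _) (hasSum_norm_sq_fcoeff y)

/-- Pairing with an element having NO coefficients on the symmetric finite set `S`: only the non-`S` energy of `y` counts,
`|⟪y, w⟫| ≤ √(‖y‖² − Σ_S‖𝓕y‖²) · ‖w‖`. -/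
theorem abs_inner_le_of_support_off (S : Finset (Fin 3 → ℤ)) (hS : ∀ k, k ∈ S ↔ -k ∈ S) (y w : V2)
    (hw : ∀ k, k ∈ S → mFourierCoeff (EuclideanSpace.complexify ∘ ⇑w) k = 0) :
    |⟪y, w⟫_ℝ| ≤ Real.sqrt (‖y‖ ^ 2 - ∑ k ∈ S, ‖mFourierCoeff (EuclideanSpace.complexify ∘ ⇑y) k‖ ^ 2) * ‖w‖ := by
  -- the projector onto the `S`-modes
  obtain ⟨P, hP⟩ := exists_labelProj (↑S : Set (Fin 3 → ℤ)) (fun k => by simpa using hS k)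
  have hPy : ∀ k, k ∉ S → mFourierCoeff (EuclideanSpace.complexify ∘ ⇑(P y)) k = 0 := fun k hk => by
    rw [hP]; simp [hk]
  -- `⟪P y, w⟫ = 0` (disjoint supports) and `⟪y, w⟫ = ⟪y − P y, w⟫`
  have h0 : ⟪P y, w⟫_ℝ = 0 := inner_eq_zero_of_disjoint_fcoeff fun k => by
    by_cases hk : k ∈ S
    · right; exact hw k hk
    · left; exact hPy k hk
  have h1 : ⟪y, w⟫_ℝ = ⟪y - P y, w⟫_ℝ := by rw [inner_sub_left, h0, sub_zero]
  -- `‖y − P y‖² = ‖y‖² − Σ_S ‖𝓕y‖²`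
  have h2 : ‖P y‖ ^ 2 = ∑ k ∈ S, ‖mFourierCoeff (EuclideanSpace.complexify ∘ ⇑y) k‖ ^ 2 := by
    rw [norm_sq_eq_sum_of_support S (P y) hPy]
    exact Finset.sum_congr rfl fun k hk => by rw [hP]; simp [hk]
  have h3 : ⟪y - P y, P y⟫_ℝ = 0 := by
    refine inner_eq_zero_of_disjoint_fcoeff fun k => ?_
    by_cases hk : k ∈ S
    · left; rw [fcoeff_sub, hP]; simp [hk]
    · right; exact hPy k hk
  have h4 : ‖y - P y‖ ^ 2 = ‖y‖ ^ 2 - ‖P y‖ ^ 2 := by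
    have e : y = (y - P y) + P y := by abel
    have h := norm_add_sq_real (y - P y) (P y)
    rw [← e, h3] at h
    linarith
  rw [h1, ← h2, ← h4, Real.sqrt_sq (norm_nonneg _)]
  exact abs_real_inner_le_norm _ _

/-! ## (Z) from the pieces -/

set_option maxHeartbeats 400000 in
/-- **(Z) from its pieces** (operator form of `dd_assembly_op`).  See the module docstring. -/
theorem z_of_pieces (S : Finset (Fin 3 → ℤ)) (hS : ∀ k, k ∈ S ↔ -k ∈ S) (u y e e_d e_c e_l e_f : V2)
    (d κ κ' : (Fin 3 → ℤ) → ℝ) {D Dstar c η₁ η₂ η₃ η₄ η₅ : ℝ}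
    (hsplit : e = e_d + e_c + e_l + e_f)
    (hd : ∀ k, 0 ≤ d k) (hc : 0 < c) (hη₁ : 0 ≤ η₁) (hη₂ : 0 ≤ η₂) (hη₃ : 0 ≤ η₃) (hη₄ : 0 ≤ η₄) (hη₅ : 0 ≤ η₅)
    (hκd : ∀ k, κ k ≤ η₄ ^ 2 * d k) (hκ'd : ∀ k, κ' k ≤ η₅ ^ 2 * d k) (hκ'0 : ∀ k, 0 < κ' k)
    -- supports
    (hd_supp : ∀ k, k ∉ S → mFourierCoeff (EuclideanSpace.complexify ∘ ⇑e_d) k = 0)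
    (hl_supp : ∀ k, k ∉ S → mFourierCoeff (EuclideanSpace.complexify ∘ ⇑e_l) k = 0)
    (hf_supp : ∀ k, k ∈ S → mFourierCoeff (EuclideanSpace.complexify ∘ ⇑e_f) k = 0)
    -- the four pieces
    (hdiag : ∀ k, k ∈ S → ‖mFourierCoeff (EuclideanSpace.complexify ∘ ⇑e_d) k‖
        ≤ η₁ * d k * ‖mFourierCoeff (EuclideanSpace.complexify ∘ ⇑u) k‖)
    (hcross : |⟪y, e_c⟫_ℝ| ≤ η₂
        * Real.sqrt (∑ k ∈ S, d k * ‖mFourierCoeff (EuclideanSpace.complexify ∘ ⇑u) k‖ ^ 2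
            + (‖u‖ ^ 2 - ∑ k ∈ S, ‖mFourierCoeff (EuclideanSpace.complexify ∘ ⇑u) k‖ ^ 2))
        * Real.sqrt (∑ k ∈ S, d k * ‖mFourierCoeff (EuclideanSpace.complexify ∘ ⇑y) k‖ ^ 2
            + (‖y‖ ^ 2 - ∑ k ∈ S, ‖mFourierCoeff (EuclideanSpace.complexify ∘ ⇑y) k‖ ^ 2)))
    (hleak : ∑ k ∈ S, ‖mFourierCoeff (EuclideanSpace.complexify ∘ ⇑e_l) k‖ ^ 2 / κ' k
        ≤ ‖u‖ ^ 2 - ∑ k ∈ S, ‖mFourierCoeff (EuclideanSpace.complexify ∘ ⇑u) k‖ ^ 2)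
    (hfast : ‖e_f‖ ≤ Real.sqrt (∑ k ∈ S, κ k * ‖mFourierCoeff (EuclideanSpace.complexify ∘ ⇑u) k‖ ^ 2)
        + η₃ * Real.sqrt (‖u‖ ^ 2 - ∑ k ∈ S, ‖mFourierCoeff (EuclideanSpace.complexify ∘ ⇑u) k‖ ^ 2))
    -- the floors
    (hD : c * (∑ k ∈ S, d k * ‖mFourierCoeff (EuclideanSpace.complexify ∘ ⇑u) k‖ ^ 2
        + (‖u‖ ^ 2 - ∑ k ∈ S, ‖mFourierCoeff (EuclideanSpace.complexify ∘ ⇑u) k‖ ^ 2)) ≤ D)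
    (hDstar : c * (∑ k ∈ S, d k * ‖mFourierCoeff (EuclideanSpace.complexify ∘ ⇑y) k‖ ^ 2
        + (‖y‖ ^ 2 - ∑ k ∈ S, ‖mFourierCoeff (EuclideanSpace.complexify ∘ ⇑y) k‖ ^ 2)) ≤ Dstar) :
    |⟪y, e⟫_ℝ| ≤ (η₁ + η₂ + η₃ + η₄ + η₅) / c * Real.sqrt D * Real.sqrt Dstar := by
  -- abbreviations for the profiles
  set σ : (Fin 3 → ℤ) → ℝ := fun k => ‖mFourierCoeff (EuclideanSpace.complexify ∘ ⇑u) k‖ with hσ_def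
  set yy : (Fin 3 → ℤ) → ℝ := fun k => ‖mFourierCoeff (EuclideanSpace.complexify ∘ ⇑y) k‖ with hyy_def
  have hFsq : 0 ≤ ‖u‖ ^ 2 - ∑ k ∈ S, σ k ^ 2 := by
    have := sum_norm_sq_fcoeff_le S u; rw [hσ_def]; linarith
  have hYsq : 0 ≤ ‖y‖ ^ 2 - ∑ k ∈ S, yy k ^ 2 := by
    have := sum_norm_sq_fcoeff_le S y; rw [hyy_def]; linarith
  set F : ℝ := Real.sqrt (‖u‖ ^ 2 - ∑ k ∈ S, σ k ^ 2) with hF_def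
  set Yf : ℝ := Real.sqrt (‖y‖ ^ 2 - ∑ k ∈ S, yy k ^ 2) with hYf_def
  have hF0 : 0 ≤ F := Real.sqrt_nonneg _
  have hYf0 : 0 ≤ Yf := Real.sqrt_nonneg _
  have hF2 : F ^ 2 = ‖u‖ ^ 2 - ∑ k ∈ S, σ k ^ 2 := Real.sq_sqrt hFsq
  have hYf2 : Yf ^ 2 = ‖y‖ ^ 2 - ∑ k ∈ S, yy k ^ 2 := Real.sq_sqrt hYsq
  -- the four pairings
  have hsum : ⟪y, e⟫_ℝ = ⟪y, e_d⟫_ℝ + ⟪y, e_c⟫_ℝ + ⟪y, e_f⟫_ℝ + ⟪y, e_l⟫_ℝ := by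
    rw [hsplit, inner_add_right, inner_add_right, inner_add_right]; ring
  -- A_diag
  have hAdiag : |⟪y, e_d⟫_ℝ| ≤ ∑ k ∈ S, yy k * (η₁ * d k * σ k) := by
    rw [inner_eq_sum_of_support S y e_d hd_supp]
    refine (Finset.abs_sum_le_sum_abs _ _).trans (Finset.sum_le_sum fun k hk => ?_)
    calc |(inner ℂ (mFourierCoeff (EuclideanSpace.complexify ∘ ⇑y) k) (mFourierCoeff (EuclideanSpace.complexify ∘ ⇑e_d) k)).re|
        ≤ ‖inner ℂ (mFourierCoeff (EuclideanSpace.complexify ∘ ⇑y) k) (mFourierCoeff (EuclideanSpace.complexify ∘ ⇑e_d) k)‖ :=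
          Complex.abs_re_le_norm _
      _ ≤ ‖mFourierCoeff (EuclideanSpace.complexify ∘ ⇑y) k‖ * ‖mFourierCoeff (EuclideanSpace.complexify ∘ ⇑e_d) k‖ :=
          norm_inner_le_norm _ _
      _ ≤ yy k * (η₁ * d k * σ k) := mul_le_mul_of_nonneg_left (hdiag k hk) (norm_nonneg _)
  -- A_fast
  have hAfast : |⟪y, e_f⟫_ℝ| ≤ Yf * (Real.sqrt (∑ k ∈ S, κ k * σ k ^ 2) + η₃ * F) := by
    have h := abs_inner_le_of_support_off S hS y e_f hf_supp
    exact h.trans (mul_le_mul_of_nonneg_left hfast hYf0)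
  -- A_leak: `|⟪y, e_l⟫| ≤ Σ_S ‖ŷ‖‖ê_l‖ ≤ √(Σ κ′ y²) √(Σ ê_l²/κ′) ≤ F √(Σ κ′ y²)`
  have hAleak : |⟪y, e_l⟫_ℝ| ≤ F * Real.sqrt (∑ k ∈ S, κ' k * yy k ^ 2) := by
    rw [inner_eq_sum_of_support S y e_l hl_supp]
    have h1 : |∑ k ∈ S, (inner ℂ (mFourierCoeff (EuclideanSpace.complexify ∘ ⇑y) k)
        (mFourierCoeff (EuclideanSpace.complexify ∘ ⇑e_l) k)).re|
        ≤ ∑ k ∈ S, (Real.sqrt (κ' k) * yy k) * (‖mFourierCoeff (EuclideanSpace.complexify ∘ ⇑e_l) k‖ / Real.sqrt (κ' k)) := by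
      refine (Finset.abs_sum_le_sum_abs _ _).trans (Finset.sum_le_sum fun k hk => ?_)
      have hk0 : 0 < Real.sqrt (κ' k) := Real.sqrt_pos.2 (hκ'0 k)
      calc |(inner ℂ (mFourierCoeff (EuclideanSpace.complexify ∘ ⇑y) k) (mFourierCoeff (EuclideanSpace.complexify ∘ ⇑e_l) k)).re|
          ≤ ‖inner ℂ (mFourierCoeff (EuclideanSpace.complexify ∘ ⇑y) k) (mFourierCoeff (EuclideanSpace.complexify ∘ ⇑e_l) k)‖ :=
            Complex.abs_re_le_norm _
        _ ≤ yy k * ‖mFourierCoeff (EuclideanSpace.complexify ∘ ⇑e_l) k‖ := norm_inner_le_norm _ _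
        _ = (Real.sqrt (κ' k) * yy k) * (‖mFourierCoeff (EuclideanSpace.complexify ∘ ⇑e_l) k‖ / Real.sqrt (κ' k)) := by
            field_simp
    have h2 := Real.sum_mul_le_sqrt_mul_sqrt S (fun k => Real.sqrt (κ' k) * yy k)
      (fun k => ‖mFourierCoeff (EuclideanSpace.complexify ∘ ⇑e_l) k‖ / Real.sqrt (κ' k))
    have h3 : ∑ k ∈ S, (Real.sqrt (κ' k) * yy k) ^ 2 = ∑ k ∈ S, κ' k * yy k ^ 2 :=
      Finset.sum_congr rfl fun k _ => by rw [mul_pow, Real.sq_sqrt (hκ'0 k).le]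
    have h4 : ∑ k ∈ S, (‖mFourierCoeff (EuclideanSpace.complexify ∘ ⇑e_l) k‖ / Real.sqrt (κ' k)) ^ 2
        = ∑ k ∈ S, ‖mFourierCoeff (EuclideanSpace.complexify ∘ ⇑e_l) k‖ ^ 2 / κ' k :=
      Finset.sum_congr rfl fun k _ => by rw [div_pow, Real.sq_sqrt (hκ'0 k).le]
    rw [h3, h4] at h2
    have h5 : Real.sqrt (∑ k ∈ S, ‖mFourierCoeff (EuclideanSpace.complexify ∘ ⇑e_l) k‖ ^ 2 / κ' k) ≤ F := by
      rw [hF_def]; exact Real.sqrt_le_sqrt (by rw [hσ_def]; exact hleak)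
    calc _ ≤ _ := h1
      _ ≤ Real.sqrt (∑ k ∈ S, κ' k * yy k ^ 2) * Real.sqrt (∑ k ∈ S, ‖mFourierCoeff (EuclideanSpace.complexify ∘ ⇑e_l) k‖ ^ 2 / κ' k) := h2
      _ ≤ Real.sqrt (∑ k ∈ S, κ' k * yy k ^ 2) * F := mul_le_mul_of_nonneg_left h5 (Real.sqrt_nonneg _)
      _ = F * Real.sqrt (∑ k ∈ S, κ' k * yy k ^ 2) := mul_comm _ _
  -- A_cross in the `F`, `Yf` currency
  have hAcross : |⟪y, e_c⟫_ℝ| ≤ η₂ * Real.sqrt (∑ k ∈ S, d k * σ k ^ 2 + F ^ 2) * Real.sqrt (∑ k ∈ S, d k * yy k ^ 2 + Yf ^ 2) := by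
    rw [hF2, hYf2]; exact hcross
  -- assemble with `dd_assembly_op`
  have hDD := dd_assembly_op S d σ yy κ κ' (F := F) (Yf := Yf) (D := D) (Dstar := Dstar) (c := c)
    (Adiag := ⟪y, e_d⟫_ℝ) (Across := ⟪y, e_c⟫_ℝ) (Afast := ⟪y, e_f⟫_ℝ) (Aleak := ⟪y, e_l⟫_ℝ)
    hd hF0 hYf0 hc hη₁ hη₂ hη₃ hη₄ hη₅ hκd hκ'd hAdiag hAcross hAfast hAleak (by rw [hF2]; exact hD) (by rw [hYf2]; exact hDstar)
  rw [hsum]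
  exact hDD

end Summit.AnomalousDissipation.AnomalousDissipation.Theorems.SolenoidalFractalHomogenisation.LagrangianStep

end
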